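import Summits.BirchSwinnertonDyer.BirchSwinnertonDyer.Theorems.AdditiveRankOneHalvesOfFlatInclusions
import Summits.BirchSwinnertonDyer.BirchSwinnertonDyer.Theorems.AdditiveWildRankOneTowerSurjOfKato
import Summits.BirchSwinnertonDyer.BirchSwinnertonDyer.Theorems.AdditiveRankOneControlLeOfPoitouTate
import HarnessLib

/-!
# The r = 1 LOWER half at an additive prime from the Eisenstein ♭-inclusion, RE-KEYED to the control INEQUALITY: on the
# potentially supersingular rows (every odd `p`, `ClassO5 ∨ ClassO6`) and on the tower-surjective wild rows at `3` the lower
# half costs ONE cohomological named fact (`poitouTate_selmerStructure_duality`) instead of seven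

Cell `bsd-wall` (W-ALL row 2·3@3, lane 3), seat `bsd-wall-utd-p3` (prover, gen 6), 2026-08-28. Sequel of
`Theorems/AdditiveRankOneControlLeOfPoitouTate.lean` (this seat: `AdditiveControlLeOnTreeAt … 0 P` + CTL₀ at every frame of every
Heegner datum of an additive curve from `poitouTate_selmerStructure_duality` and Kolyvagin ALONE, any reduction type, `p ≠ 2`)
applied to bsd-potss-kmc g20's ♭-currency road (`AdditiveRankOneBSDpRowKernels` §1, `AdditiveRankOneHalvesOfFlatInclusions` §2–§3,
`AdditivePotSupersingularRankOneTowerSurjOfKato` §2, `AdditiveWildRankOneTowerSurjOfKato` §2): those theorems consumed the control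
EQUALITY only through K1's STEP L link, i.e. only as `≤`; the EQUALITY is where `poitouTate_sha_tateDual`, Serre 1967 / Fin_v,
local Euler–Poincaré, cd ≤ 2 and Brink entered (`additiveControl_heegner_potSS_of_facts_of_serre1967`).

* §1 `indexLowerBoundLeAt_of_flatInclLe_of_controlLe` — STEP L at slack `v_p(c)` from the ♭-inclusion + `≤`-control (one datum).
* §2 `missingLowerBoundAt_of_flatEisenstein_of_controlLe_of_twistUpper_row` — row-local lower half, control as `≤`.
* §3 `missingLowerBoundAt_potSS_rankOne_of_flatEisenstein_of_twistUpper_of_poitouTate` — every odd additive potentially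
  supersingular prime (K9 / KT rows), control DISCHARGED from PT1 alone.
* §4 `missingLowerBoundAt_potSS_towerSurj_of_flatEisenstein_of_katoTam_of_poitouTate`,
  `missingLowerBoundAt_wildRankOne_towerSurj_of_flatEisenstein_of_katoTam_of_poitouTate` — tower-surjective rows, twist's upper
  half by Kato A161″: the r = 1 LOWER half ⟸ X (research) ∧ A161″ ∧ PT1 ∧ Hsieh ∧ LZZ ∧ ToricPublishedInputs.

HONEST FRAMING: CONDITIONAL on every displayed hypothesis; theorems only (kmc's proofs verbatim with the control binder
re-typed); closes nothing; BSD_p for no curve. Every UPPER-half / exact statement still needs the control EQUALITY (PT2).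

References: [JetchevSkinnerWan2017] §7.4.1, Thm. 3.3.1; [Hsieh2014] Thm. A; [LiuZhangZhang2018] Thm 1.5.1/1.5.3;
[Kato2004Asterisque] Thm. 14.5 (3), Prop. 14.16 (2); [MilneADT2006] I Thm. 4.10(b); [GrossZagier1986] I.(6.3); [Kolyvagin1990] Thm. A.
-/

noncomputable section

open scoped Classical

set_option linter.dupNamespace false
set_option autoImplicit false

namespace Summit.BirchSwinnertonDyer.BirchSwinnertonDyer.Theorems.AdditiveRankOneFlatLowerHalfControlLe

open WeierstrassCurve NumberField IsDedekindDomain Field PowerSeries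
  Literature.NumberTheory.EllipticCurves
  Literature.NumberTheory.EllipticCurves.ModularForms
  Literature.NumberTheory.EllipticCurves.Rank1Residual
  Literature.NumberTheory.EllipticCurves.Rank1Residual.Typed
  Literature.NumberTheory.EllipticCurves.KrizLi2019
  Literature.NumberTheory.GaloisRepresentations
  Literature.NumberTheory.GaloisCohomology
  Summit.BirchSwinnertonDyer.Rank1Residual
  Summit.BirchSwinnertonDyer.Rank1Residual.Additive
  Summit.BirchSwinnertonDyer.Rank1Residual.X11b
  Summit.BirchSwinnertonDyer.Rank1Residual.X11b.AcSelmer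
  Summit.BirchSwinnertonDyer.Rank1Residual.X11b.Halves
  Summit.BirchSwinnertonDyer.Rank1Residual.X11b.CongruenceLimit
  Summit.BirchSwinnertonDyer.BirchSwinnertonDyer.Theses.UniversalToricDescent
  Summit.BirchSwinnertonDyer.BirchSwinnertonDyer.Theorems.AdditivePotSupersingularControl
  Summit.BirchSwinnertonDyer.BirchSwinnertonDyer.Theorems.UniversalToricDescentWaldspurgerFlat
  Summit.BirchSwinnertonDyer.BirchSwinnertonDyer.Theorems.SchneiderFreeControlAtoms
  Summit.BirchSwinnertonDyer.BirchSwinnertonDyer.Theorems.AdditiveRankOneControlLe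

/-! ## §1 STEP L from the Eisenstein ♭-inclusion and the control INEQUALITY (one datum) -/

section Datum

variable {p : ℕ} [Fact p.Prime] {W : WeierstrassCurve ℚ} [W.IsElliptic] [W.IsGloballyMinimal]
  {N : ℕ} [NeZero N] {K : Type} [Field K] [NumberField K]

/-- **STEP L at slack `v_p(c)` from the Eisenstein ♭-inclusion + the control INEQUALITY** — kmc g20's
`indexLowerBoundLeAt_of_flatInclLe_of_control` VERBATIM with `hCtl` weakened from the control EQUALITY to the `≤` half
`AdditiveControlLeOnTreeAt … 0 P` (the proof used control only in K1's STEP L link, i.e. only as `≤`: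
`AdditiveRankOneControlLe.indexLowerBoundLeAt_of_imcLowerLe_of_controlLe_zero`). One Heegner datum of `W` additive at the odd
`p`; frame and unit value by Hsieh + LZZ (`exists_frameInt_value_manin`). CONDITIONAL; closes nothing.
[cite: JetchevSkinnerWan2017, §7.4.1 (arXiv:1512.06894 p. 30)] [cite: Hsieh2014, Thm. A p. 712 (Doc. Math. 19)]
[cite: LiuZhangZhang2018, Thm 1.5.1 and Thm 1.5.3 (Duke Math. J. 167 pp. 748–749)] -/
theorem indexLowerBoundLeAt_of_flatInclLe_of_controlLe (hp2 : p ≠ 2)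
    (hA : Hsieh2014.thmA_exists_isHsiehLFunction_unrPeriod_anyLevel)
    (hL : LiuZhangZhang2018.thm151_thm153_modularCurve_heegnerVector_additive)
    (Dt : ModularParametrizationData W N) (H : HeegnerDatum N (NumberField.discr K)) (ι : K →+* ℂ)
    (P : (W.baseChange K).toAffine.Point) (haddv : Addv W p) (hN : W.conductorNorm ℤ = N) (hK : IsImaginaryQuadratic K)
    (hHN : SatisfiesHeegnerHypothesis N K) (hd4 : NumberField.discr K < -4)
    (hP : WeierstrassCurve.Affine.Point.map ι.toRatAlgHom P = heegnerPointComplex Dt H) (hnt : ¬ IsOfFinAddOrder P)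
    (hKo : Literature.NumberTheory.EllipticCurves.kolyvagin N W K)
    (hIncl : ∀ (κ : ZpExtension K p), κ.IsAnticyclotomic → ∀ (γ : Field.absoluteGaloisGroup K) [Fact (κ.IsTopGenerator γ)]
        (𝔭 : HeightOneSpectrum (𝓞 K)), ((p : ℕ) : 𝓞 K) ∈ 𝔭.asIdeal → 𝔭.asIdeal.ramificationIdx (𝓞 ℚ) = 1 →
        𝔭.asIdeal.inertiaDeg (𝓞 ℚ) = 1 → ∀ (𝔭' : HeightOneSpectrum (𝓞 K)), ((p : ℕ) : 𝓞 K) ∈ 𝔭'.asIdeal → 𝔭' ≠ 𝔭 →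
        ∀ (ι' : PadicAlgCl p ≃+* ℂ), SchneiderFree.BranchInducesPrime p ι' 𝔭 →
        ∀ (ΩK : ℂ) (Ωp : ℂ_[p]) (Q : PowerSeries (PadicComplexInt p)), ΩK ≠ 0 → Ωp ≠ 0 →
          R1.IsBDPLFunctionInt p ι' 𝔭 κ γ Dt.f ΩK Ωp Q →
          (XAc.charIdeal (W.baseChange K) p κ 𝔭' ∅ γ).map (PowerSeries.map (R1.toCpInt p)) ≤ Ideal.span {Q})
    (hCtl : ∀ (κ : ZpExtension K p), κ.IsAnticyclotomic → ∀ (γ : Field.absoluteGaloisGroup K) [Fact (κ.IsTopGenerator γ)]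
        (𝔭 : HeightOneSpectrum (𝓞 K)) (h𝔭 : ((p : ℕ) : 𝓞 K) ∈ 𝔭.asIdeal) (he : 𝔭.asIdeal.ramificationIdx (𝓞 ℚ) = 1)
        (hf : 𝔭.asIdeal.inertiaDeg (𝓞 ℚ) = 1), AdditiveControlLeOnTreeAt p κ 𝔭 γ (embAt K p 𝔭 h𝔭 he hf) 0 P) :
    SchneiderFree.IndexLowerBoundLeAt W p K P (padicValNat p Dt.c.natAbs) := by
  have hp : p.Prime := Fact.out
  have hpN : p ∣ W.conductorNorm ℤ :=
    (W.dvd_conductorNorm_iff_not_hasGoodReductionAtPrime p).mpr (not_good_of_addv W p haddv)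
  have hsplit : SplitsIn K p := by rw [hN] at hpN; exact hHN p hp hpN
  have hp2N : p ^ 2 ∣ N := by
    rw [← hN]
    by_contra h
    rcases hasGoodReductionAtPrime_or_hasMultiplicativeReductionAtPrime_of_not_sq_dvd_conductorNorm (V := W) h
      with hg | hm
    · exact haddv.1 hg
    · exact haddv.2 hm
  obtain ⟨hrk, hfin⟩ := hKo hK hHN ⟨Dt, H, ι, hP⟩ hnt
  -- a frame `(κ, γ, 𝔭, 𝔭′ ≠ 𝔭)`, an embedding datum inducing `𝔭`, the ♭-frame there and its unit value (Hsieh + LZZ)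
  obtain ⟨κ, γ, -, hκ, hγ, -⟩ := X11b.exists_anticyclotomic_generator_prime (p := p) hK
  haveI : Fact (κ.IsTopGenerator γ) := ⟨hγ⟩
  obtain ⟨𝔭, h𝔭, he, hf⟩ := X11b.exists_degreeOnePrime_of_splitsIn K p hK.1 hsplit
  obtain ⟨𝔭', hne, h𝔭', he', hf'⟩ := X11b.Three.exists_ne_degreeOne_prime hK.1 h𝔭 he hf
  obtain ⟨ι₀⟩ := PadicAlgCl.nonempty_ringEquiv_complex p
  obtain ⟨ι', -, hind⟩ := exists_datum_forall_mem_iff p ι₀ hK h𝔭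
  obtain ⟨ΩK, Ωp', Q, hΩK, hBDP, u, hu, hval⟩ :=
    exists_frameInt_value_manin hA hL W K 𝔭 κ γ Dt H ι P hp2 hN hp2N hK hd4 h𝔭 he hf hHN hκ hP hnt ι' hind
  have hΩp : ((Ωp' : unrIntegers p) : ℂ_[p]) ≠ 0 := fun h0 ↦ by
    have h1 := norm_coe_units_unrIntegers p Ωp'; rw [h0, norm_zero] at h1; exact zero_ne_one h1
  have hle : (XAc.charIdeal (W.baseChange K) p κ 𝔭' ∅ γ).map (PowerSeries.map (R1.toCpInt p)) ≤ Ideal.span {Q} :=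
    hIncl κ hκ γ 𝔭 h𝔭 he hf 𝔭' h𝔭' hne ι' hind ΩK _ Q hΩK hΩp hBDP
  obtain ⟨n, hn, hnle⟩ := hCtl κ hκ γ 𝔭' h𝔭' he' hf'
  have hc0 : Dt.c ≠ 0 := Dt.maninConstant_ne_zero_holds
  have hc0' : (Dt.c : ℚ_[p]) ≠ 0 := by exact_mod_cast hc0
  have hlog : logOmega W p (embAt K p 𝔭' h𝔭' he' hf') P ≠ 0 := X11b.R1.logOmega_ne_zero W p _ hnt
  have hsq : (algebraMap ℚ_[p] ℂ_[p] (logOmega W p (embAt K p 𝔭 h𝔭 he hf) P / (Dt.c : ℚ_[p]))) ^ 2 =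
      (algebraMap ℚ_[p] ℂ_[p] (logOmega W p (embAt K p 𝔭' h𝔭' he' hf') P / (Dt.c : ℚ_[p]))) ^ 2 := by
    rw [← map_pow, ← map_pow, div_pow, div_pow,
      SchneiderFreeAdditiveX3.sq_logOmega_embAt_eq_of_rank_one W p hK.1 hrk h𝔭 he hf h𝔭' he' hf' P]
  have hval' : IntSeries.HasValueAt Q 0
      (u * (algebraMap ℚ_[p] ℂ_[p] (logOmega W p (embAt K p 𝔭' h𝔭' he' hf') P / (Dt.c : ℚ_[p]))) ^ 2) := by
    rw [← hsq]; exact hval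
  have hlow : SchneiderFree.AdditiveIMCLowerBDPOnTreeLeAt p κ 𝔭' γ (embAt K p 𝔭' h𝔭' he' hf')
      (padicValNat p Dt.c.natAbs) P := by
    obtain ⟨htors, f, hfI, hf0, hfn⟩ := hn
    have hmem : PowerSeries.map (R1.toCpInt p) f ∈ Ideal.span {Q} := by
      have h3 := hle
      rw [hfI, map_span_singleton_powerSeries] at h3
      exact (Ideal.span_singleton_le_iff_mem _).mp h3
    obtain ⟨-, hle'⟩ := int_two_mul_valuation_le_of_map_mem_span hf0 hmem hu hval'
    rw [div_eq_mul_inv, Padic.valuation_mul hlog (inv_ne_zero hc0'), Padic.valuation_inv,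
      Padic.valuation_intCast, valuation_logOmega hlog, hfn] at hle'
    refine ⟨n, ⟨htors, f, hfI, hf0, hfn⟩, ?_⟩
    simp only [padicValInt] at hle'
    linarith
  exact indexLowerBoundLeAt_of_imcLowerLe_of_controlLe_zero hN hK hHN hfin hlow ⟨n, hn, hnle⟩

end Datum

/-! ## §2 The row-local lower half, control as `≤` -/

/-- **The r = 1 LOWER half `MissingLowerBoundAt W p` at ANY odd additive prime from the Eisenstein ♭-inclusion (X), the
control INEQUALITY, Hsieh + LZZ and the twists' r = 0 UPPER half — ROW-LOCAL** (kmc g20's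
`missingLowerBoundAt_of_flatEisenstein_of_control_of_twistUpper_row` with control weakened to `≤`).
`= missingLowerBoundAt_of_indexLower_of_twistUpper_row ∘ indexLowerBoundLeAt_of_flatInclLe_of_controlLe`. CONDITIONAL.
[cite: JetchevSkinnerWan2017, §7.4.1 (arXiv:1512.06894 p. 30)] [cite: Hsieh2014, Thm. A p. 712 (Doc. Math. 19)]
[cite: LiuZhangZhang2018, Thm 1.5.1 and Thm 1.5.3 (Duke Math. J. 167 pp. 748–749)] [cite: GrossZagier1986, I.(6.3)] -/
theorem missingLowerBoundAt_of_flatEisenstein_of_controlLe_of_twistUpper_row (p : ℕ) [Fact p.Prime] (hp2 : p ≠ 2)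
    (hA : Hsieh2014.thmA_exists_isHsiehLFunction_unrPeriod_anyLevel)
    (hL : LiuZhangZhang2018.thm151_thm153_modularCurve_heegnerVector_additive)
    (hF : ToricPublishedInputs)
    (W : WeierstrassCurve ℚ) [W.IsElliptic] [W.IsGloballyMinimal] (haddv : Addv W p) (hr : W.analyticRank = 1)
    (hIncl : ∀ (N : ℕ) [NeZero N] (K : Type) [Field K] [NumberField K] (Dt : ModularParametrizationData W N),
      W.conductorNorm ℤ = N → IsImaginaryQuadratic K → SatisfiesHeegnerHypothesis N K →
      ∀ (κ : ZpExtension K p), κ.IsAnticyclotomic → ∀ (γ : Field.absoluteGaloisGroup K) [Fact (κ.IsTopGenerator γ)]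
        (𝔭 : HeightOneSpectrum (𝓞 K)), ((p : ℕ) : 𝓞 K) ∈ 𝔭.asIdeal → 𝔭.asIdeal.ramificationIdx (𝓞 ℚ) = 1 →
        𝔭.asIdeal.inertiaDeg (𝓞 ℚ) = 1 → ∀ (𝔭' : HeightOneSpectrum (𝓞 K)), ((p : ℕ) : 𝓞 K) ∈ 𝔭'.asIdeal → 𝔭' ≠ 𝔭 →
        ∀ (ι' : PadicAlgCl p ≃+* ℂ), SchneiderFree.BranchInducesPrime p ι' 𝔭 →
        ∀ (ΩK : ℂ) (Ωp : ℂ_[p]) (Q : PowerSeries (PadicComplexInt p)), ΩK ≠ 0 → Ωp ≠ 0 →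
          R1.IsBDPLFunctionInt p ι' 𝔭 κ γ Dt.f ΩK Ωp Q →
          (XAc.charIdeal (W.baseChange K) p κ 𝔭' ∅ γ).map (PowerSeries.map (R1.toCpInt p)) ≤ Ideal.span {Q})
    (hCtl : ∀ (N : ℕ) [NeZero N] (K : Type) [Field K] [NumberField K] (Dt : ModularParametrizationData W N)
      (H : HeegnerDatum N (NumberField.discr K)) (ι : K →+* ℂ) (P : (W.baseChange K).toAffine.Point),
      W.conductorNorm ℤ = N → IsImaginaryQuadratic K → SatisfiesHeegnerHypothesis N K →
      (W.quadraticTwist (NumberField.discr K : ℚ)).entireLFunction 1 ≠ 0 →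
      WeierstrassCurve.Affine.Point.map ι.toRatAlgHom P = heegnerPointComplex Dt H → ¬ IsOfFinAddOrder P →
      Literature.NumberTheory.EllipticCurves.kolyvagin N W K →
      ∀ (κ : ZpExtension K p), κ.IsAnticyclotomic → ∀ (γ : Field.absoluteGaloisGroup K) [Fact (κ.IsTopGenerator γ)]
        (𝔭 : HeightOneSpectrum (𝓞 K)) (h𝔭 : ((p : ℕ) : 𝓞 K) ∈ 𝔭.asIdeal) (he : 𝔭.asIdeal.ramificationIdx (𝓞 ℚ) = 1)
        (hf : 𝔭.asIdeal.inertiaDeg (𝓞 ℚ) = 1),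
        AdditiveControlLeOnTreeAt p κ 𝔭 γ (embAt K p 𝔭 h𝔭 he hf) 0 P)
    (hTwUp : ∀ (N : ℕ) [NeZero N] (K : Type) [Field K] [NumberField K]
      (Wd : WeierstrassCurve ℚ) [Wd.IsElliptic] [Wd.IsGloballyMinimal],
      W.conductorNorm ℤ = N → IsImaginaryQuadratic K → SatisfiesHeegnerHypothesis N K →
      (∃ C : VariableChange ℚ, C • W.quadraticTwist (NumberField.discr K : ℚ) = Wd) →
      (W.quadraticTwist (NumberField.discr K : ℚ)).entireLFunction 1 ≠ 0 → MissingUpperBoundAt Wd p) :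
    MissingLowerBoundAt W p := by
  have hKo : ∀ (N : ℕ) [NeZero N] (W : WeierstrassCurve ℚ) (K : Type) [Field K] [NumberField K],
      Literature.NumberTheory.EllipticCurves.kolyvagin N W K := hF.2.1
  refine missingLowerBoundAt_of_indexLower_of_twistUpper_row p hp2 hF W haddv hr ?_ hTwUp
  intro N _ K _ _ Dt H ι P hN hK hHN _hodd hd4 hLt hP hnt
  exact indexLowerBoundLeAt_of_flatInclLe_of_controlLe hp2 hA hL Dt H ι P haddv hN hK hHN hd4 hP hnt (hKo N W K)
    (fun κ hκ γ _ 𝔭 h𝔭 he hf 𝔭' h𝔭' hne ι' hind ΩK Ωp Q hΩK hΩp hBDP ↦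
      hIncl N K Dt hN hK hHN κ hκ γ 𝔭 h𝔭 he hf 𝔭' h𝔭' hne ι' hind ΩK Ωp Q hΩK hΩp hBDP)
    (fun κ hκ γ _ 𝔭 h𝔭 he hf ↦ hCtl N K Dt H ι P hN hK hHN hLt hP hnt (hKo N W K) κ hκ γ 𝔭 h𝔭 he hf)

/-! ## §3 Potentially supersingular rows at every odd `p`: control discharged from PT1 alone -/

/-- **The r = 1 LOWER half at EVERY odd additive potentially SUPERSINGULAR prime (`ClassO5 ∨ ClassO6`, `ρ̄_{E,p}`
irreducible, `r_an = 1`) from the Eisenstein ♭-inclusion and the twists' r = 0 UPPER half — kmc g20's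
`missingLowerBoundAt_potSS_rankOne_of_flatEisenstein_of_twistUpper_of_facts` with its SEVEN cohomological named facts CUT TO
ONE**: the local step enters the lower half only as the control INEQUALITY, supplied from `poitouTate_selmerStructure_duality`
alone (`AdditiveRankOneControlLe.additiveControlLeOnTreeAt_of_poitouTate_of_heegner`, any reduction type); so
`poitouTate_sha_tateDual`, local Euler–Poincaré, cd ≤ 2, Brink Thm 2 / Cor 1 and Serre 1967 are NOT hypotheses, and neither is
`ρ̄` irreducibility used by the control step. Row predicate `R` arbitrary. CONDITIONAL; closes nothing; BSD_p for no curve.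
[cite: JetchevSkinnerWan2017, §7.4.1 and Thm. 3.3.1 (arXiv:1512.06894)] [cite: Hsieh2014, Thm. A p. 712 (Doc. Math. 19)]
[cite: LiuZhangZhang2018, Thm 1.5.1 and Thm 1.5.3 (Duke Math. J. 167 pp. 748–749)] [cite: MilneADT2006, Ch. I, Thm. 4.10(b)]
[cite: GrossZagier1986, I.(6.3)] -/
theorem missingLowerBoundAt_potSS_rankOne_of_flatEisenstein_of_twistUpper_of_poitouTate (p : ℕ) [Fact p.Prime]
    (R : WeierstrassCurve ℚ → Prop)
    (hA : Hsieh2014.thmA_exists_isHsiehLFunction_unrPeriod_anyLevel)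
    (hL : LiuZhangZhang2018.thm151_thm153_modularCurve_heegnerVector_additive)
    (hF : ToricPublishedInputs)
    (hPT : ∀ (K : Type) [Field K] [NumberField K], poitouTate_selmerStructure_duality K)
    (hIncl : ∀ (W : WeierstrassCurve ℚ) [W.IsElliptic] [W.IsGloballyMinimal] (N : ℕ) [NeZero N] (K : Type) [Field K]
      [NumberField K] (Dt : ModularParametrizationData W N),
      R W → (ClassO5 W p ∨ ClassO6 W p) → W.HasIrreducibleModPGaloisRep p → W.analyticRank = 1 → W.conductorNorm ℤ = N →
      IsImaginaryQuadratic K → SatisfiesHeegnerHypothesis N K →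
      ∀ (κ : ZpExtension K p), κ.IsAnticyclotomic → ∀ (γ : Field.absoluteGaloisGroup K) [Fact (κ.IsTopGenerator γ)]
        (𝔭 : HeightOneSpectrum (𝓞 K)), ((p : ℕ) : 𝓞 K) ∈ 𝔭.asIdeal → 𝔭.asIdeal.ramificationIdx (𝓞 ℚ) = 1 →
        𝔭.asIdeal.inertiaDeg (𝓞 ℚ) = 1 → ∀ (𝔭' : HeightOneSpectrum (𝓞 K)), ((p : ℕ) : 𝓞 K) ∈ 𝔭'.asIdeal → 𝔭' ≠ 𝔭 →
        ∀ (ι' : PadicAlgCl p ≃+* ℂ), SchneiderFree.BranchInducesPrime p ι' 𝔭 →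
        ∀ (ΩK : ℂ) (Ωp : ℂ_[p]) (Q : PowerSeries (PadicComplexInt p)), ΩK ≠ 0 → Ωp ≠ 0 →
          R1.IsBDPLFunctionInt p ι' 𝔭 κ γ Dt.f ΩK Ωp Q →
          (XAc.charIdeal (W.baseChange K) p κ 𝔭' ∅ γ).map (PowerSeries.map (R1.toCpInt p)) ≤ Ideal.span {Q})
    (hTwUp : ∀ (W : WeierstrassCurve ℚ) [W.IsElliptic] [W.IsGloballyMinimal] (N : ℕ) [NeZero N] (K : Type) [Field K]
      [NumberField K] (Wd : WeierstrassCurve ℚ) [Wd.IsElliptic] [Wd.IsGloballyMinimal],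
      R W → (ClassO5 W p ∨ ClassO6 W p) → W.HasIrreducibleModPGaloisRep p → W.analyticRank = 1 → W.conductorNorm ℤ = N →
      IsImaginaryQuadratic K → SatisfiesHeegnerHypothesis N K →
      (∃ C : VariableChange ℚ, C • W.quadraticTwist (NumberField.discr K : ℚ) = Wd) →
      (W.quadraticTwist (NumberField.discr K : ℚ)).entireLFunction 1 ≠ 0 → MissingUpperBoundAt Wd p) :
    ∀ (W : WeierstrassCurve ℚ) [W.IsElliptic] [W.IsGloballyMinimal],
      R W → (ClassO5 W p ∨ ClassO6 W p) → W.HasIrreducibleModPGaloisRep p → W.analyticRank = 1 →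
        MissingLowerBoundAt W p := by
  intro W _ _ hR hcls hirr hr
  have hp2 : p ≠ 2 := hcls.elim (fun h ↦ h.1) (fun h ↦ h.1)
  have haddv : Addv W p := hcls.elim (fun h ↦ h.2.1) (fun h ↦ h.2.1)
  exact missingLowerBoundAt_of_flatEisenstein_of_controlLe_of_twistUpper_row p hp2 hA hL hF W haddv hr
    (fun N _ K _ _ Dt hN hK hHN κ hκ γ _ 𝔭 h𝔭 he hf 𝔭' h𝔭' hne ι' hind ΩK Ωp Q hΩK hΩp hBDP ↦
      hIncl W N K Dt hR hcls hirr hr hN hK hHN κ hκ γ 𝔭 h𝔭 he hf 𝔭' h𝔭' hne ι' hind ΩK Ωp Q hΩK hΩp hBDP)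
    (fun N _ K _ _ Dt H ι P hN hK hHN _hLt hP hnt hKo κ hκ γ _ 𝔭 h𝔭 he hf ↦
      additiveControlLeOnTreeAt_of_poitouTate_of_heegner W p hp2 haddv N K (hPT K) Dt H ι P hN hK hHN hP hnt hKo
        κ hκ γ 𝔭 h𝔭 he hf)
    (fun N _ K _ _ Wd _ _ hN hK hHN hC hLt ↦ hTwUp W N K Wd hR hcls hirr hr hN hK hHN hC hLt)

/-! ## §4 Tower-surjective rows: the twist's upper half by Kato, control by PT1 -/

section TowerSurj

variable (p : ℕ) [Fact p.Prime] (R : WeierstrassCurve ℚ → Prop)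

/-- **The r = 1 LOWER half at EVERY odd additive potentially SUPERSINGULAR prime on the TOWER-SURJECTIVE rows from the
Eisenstein ♭-inclusion ALONE modulo print and ONE cohomological named fact** — kmc g20's
`missingLowerBoundAt_potSS_towerSurj_of_flatEisenstein_of_katoTam_of_facts` re-keyed: control as `≤` from PT1
(`additiveControlLeOnTreeAt_of_poitouTate_of_heegner`), the twist's r = 0 upper half from Kato A161″
(`missingUpperBoundAt_twist_of_towerSurj_of_katoTam`). Rows `R W`, `ClassO5 W p ∨ ClassO6 W p`, `ρ_{E,p^n}` onto for all `n`,
`r_an = 1`: `MissingLowerBoundAt W p` ⟸ `hIncl` (X, research) ∧ A161″ ∧ PT1 ∧ Hsieh ∧ LZZ ∧ ToricPublishedInputs. CONDITIONAL.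
[cite: JetchevSkinnerWan2017, §7.4.1 and Thm. 3.3.1 (arXiv:1512.06894)] [cite: Kato2004Asterisque, Thm. 14.5 (3), Prop. 14.16 (2)]
[cite: Hsieh2014, Thm. A p. 712 (Doc. Math. 19)] [cite: LiuZhangZhang2018, Thm 1.5.1 and Thm 1.5.3 (Duke Math. J. 167 pp. 748–749)]
[cite: MilneADT2006, Ch. I, Thm. 4.10(b)] [cite: GrossZagier1986, I.(6.3)] -/
theorem missingLowerBoundAt_potSS_towerSurj_of_flatEisenstein_of_katoTam_of_poitouTate
    (hA : Hsieh2014.thmA_exists_isHsiehLFunction_unrPeriod_anyLevel)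
    (hL : LiuZhangZhang2018.thm151_thm153_modularCurve_heegnerVector_additive)
    (hF : ToricPublishedInputs)
    (hKatoT : Kato2004.rankZero_padicValNat_sha_add_padicValNat_tamagawa_le_of_additive_potGood_of_imageContainsSL2)
    (hPT : ∀ (K : Type) [Field K] [NumberField K], poitouTate_selmerStructure_duality K)
    (hIncl : ∀ (W : WeierstrassCurve ℚ) [W.IsElliptic] [W.IsGloballyMinimal] (N : ℕ) [NeZero N] (K : Type) [Field K]
      [NumberField K] (Dt : ModularParametrizationData W N),
      R W → (ClassO5 W p ∨ ClassO6 W p) → (∀ n : ℕ, W.HasSurjectiveModNGaloisRep (p ^ n : ℕ)) → W.analyticRank = 1 →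
      W.conductorNorm ℤ = N → IsImaginaryQuadratic K → SatisfiesHeegnerHypothesis N K →
      ∀ (κ : ZpExtension K p), κ.IsAnticyclotomic → ∀ (γ : Field.absoluteGaloisGroup K) [Fact (κ.IsTopGenerator γ)]
        (𝔭 : HeightOneSpectrum (𝓞 K)), ((p : ℕ) : 𝓞 K) ∈ 𝔭.asIdeal → 𝔭.asIdeal.ramificationIdx (𝓞 ℚ) = 1 →
        𝔭.asIdeal.inertiaDeg (𝓞 ℚ) = 1 → ∀ (𝔭' : HeightOneSpectrum (𝓞 K)), ((p : ℕ) : 𝓞 K) ∈ 𝔭'.asIdeal → 𝔭' ≠ 𝔭 →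
        ∀ (ι' : PadicAlgCl p ≃+* ℂ), SchneiderFree.BranchInducesPrime p ι' 𝔭 →
        ∀ (ΩK : ℂ) (Ωp : ℂ_[p]) (Q : PowerSeries (PadicComplexInt p)), ΩK ≠ 0 → Ωp ≠ 0 →
          R1.IsBDPLFunctionInt p ι' 𝔭 κ γ Dt.f ΩK Ωp Q →
          (XAc.charIdeal (W.baseChange K) p κ 𝔭' ∅ γ).map (PowerSeries.map (R1.toCpInt p)) ≤ Ideal.span {Q}) :
    ∀ (W : WeierstrassCurve ℚ) [W.IsElliptic] [W.IsGloballyMinimal],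
      R W → (ClassO5 W p ∨ ClassO6 W p) → (∀ n : ℕ, W.HasSurjectiveModNGaloisRep (p ^ n : ℕ)) → W.analyticRank = 1 →
        MissingLowerBoundAt W p := by
  intro W _ _ hR hcls hsurj hr
  have hp : p.Prime := Fact.out
  have hp2 : p ≠ 2 := hcls.elim (fun h ↦ h.1) (fun h ↦ h.1)
  have haddv : Addv W p := hcls.elim (fun h ↦ h.2.1) (fun h ↦ h.2.1)
  have hj : 0 ≤ padicValRat p W.j := hcls.elim (fun h ↦ h.padicValRat_j_nonneg) (fun h ↦ h.padicValRat_j_nonneg)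
  have hGZK : rank_eq_analyticRank_of_analyticRank_le_one := hF.2.2.1
  have hmod : hasEntireLFunction_rat := hF.2.2.2.1
  exact missingLowerBoundAt_of_flatEisenstein_of_controlLe_of_twistUpper_row p hp2 hA hL hF W haddv hr
    (fun N _ K _ _ Dt hN hK hHN κ hκ γ _ 𝔭 h𝔭 he hf 𝔭' h𝔭' hne ι' hind ΩK Ωp Q hΩK hΩp hBDP ↦
      hIncl W N K Dt hR hcls hsurj hr hN hK hHN κ hκ γ 𝔭 h𝔭 he hf 𝔭' h𝔭' hne ι' hind ΩK Ωp Q hΩK hΩp hBDP)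
    (fun N _ K _ _ Dt H ι P hN hK hHN _hLt hP hnt hKo κ hκ γ _ 𝔭 h𝔭 he hf ↦
      additiveControlLeOnTreeAt_of_poitouTate_of_heegner W p hp2 haddv N K (hPT K) Dt H ι P hN hK hHN hP hnt hKo
        κ hκ γ 𝔭 h𝔭 he hf)
    (fun N _ K _ _ Wd _ _ hN hK hHN hC hLt ↦
      missingUpperBoundAt_twist_of_towerSurj_of_katoTam p hp2 hKatoT hGZK hmod W haddv hj hsurj hN K hK hHN Wd hC hLt)

end TowerSurj

section WildThree

variable [Fact (3 : ℕ).Prime] (R : WeierstrassCurve ℚ → Prop)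

/-- **The LOWER half of K9's `WildRankOne` (19200) on the `3`-adic TOWER-SURJECTIVE rows from the Eisenstein ♭-inclusion alone
modulo print and ONE cohomological named fact** — kmc g20's `missingLowerBoundAt_wildRankOne_towerSurj_of_flatEisenstein_of_katoTam_of_facts`
re-keyed (control as `≤` from PT1; `poitouTate_sha_tateDual`, local Euler–Poincaré, cd ≤ 2, Brink ×2, Serre 1967 dropped). For any
row predicate `R`: `∀ W, r_an = 1 → ClassO6 W 3 → TowerSurjThree W → R W → MissingLowerBoundAt W 3` ⟸ `hIncl` (X in ♭-currency on
the class rows — route SOED's crux) ∧ A161″ ∧ PT1 ∧ Hsieh ∧ LZZ ∧ ToricPublishedInputs. CONDITIONAL; closes nothing.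
[cite: JetchevSkinnerWan2017, §7.4.1 and Thm. 3.3.1 (arXiv:1512.06894)] [cite: Kato2004Asterisque, Thm. 14.5 (3), Prop. 14.16 (2)]
[cite: Hsieh2014, Thm. A p. 712 (Doc. Math. 19)] [cite: LiuZhangZhang2018, Thm 1.5.1 and Thm 1.5.3 (Duke Math. J. 167 pp. 748–749)]
[cite: MilneADT2006, Ch. I, Thm. 4.10(b)] [cite: GrossZagier1986, I.(6.3)] -/
theorem missingLowerBoundAt_wildRankOne_towerSurj_of_flatEisenstein_of_katoTam_of_poitouTate
    (hA : Hsieh2014.thmA_exists_isHsiehLFunction_unrPeriod_anyLevel)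
    (hL : LiuZhangZhang2018.thm151_thm153_modularCurve_heegnerVector_additive)
    (hF : ToricPublishedInputs)
    (hKatoT : Kato2004.rankZero_padicValNat_sha_add_padicValNat_tamagawa_le_of_additive_potGood_of_imageContainsSL2)
    (hPT : ∀ (K : Type) [Field K] [NumberField K], poitouTate_selmerStructure_duality K)
    (hIncl : ∀ (W : WeierstrassCurve ℚ) [W.IsElliptic] [W.IsGloballyMinimal] (N : ℕ) [NeZero N] (K : Type) [Field K]
      [NumberField K] (Dt : ModularParametrizationData W N),
      R W → ClassO6 W 3 → AdditiveThree.TowerSurjThree W → W.analyticRank = 1 →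
      W.conductorNorm ℤ = N → IsImaginaryQuadratic K → SatisfiesHeegnerHypothesis N K →
      ∀ (κ : ZpExtension K 3), κ.IsAnticyclotomic → ∀ (γ : Field.absoluteGaloisGroup K) [Fact (κ.IsTopGenerator γ)]
        (𝔭 : HeightOneSpectrum (𝓞 K)), ((3 : ℕ) : 𝓞 K) ∈ 𝔭.asIdeal → 𝔭.asIdeal.ramificationIdx (𝓞 ℚ) = 1 →
        𝔭.asIdeal.inertiaDeg (𝓞 ℚ) = 1 → ∀ (𝔭' : HeightOneSpectrum (𝓞 K)), ((3 : ℕ) : 𝓞 K) ∈ 𝔭'.asIdeal → 𝔭' ≠ 𝔭 →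
        ∀ (ι' : PadicAlgCl 3 ≃+* ℂ), SchneiderFree.BranchInducesPrime 3 ι' 𝔭 →
        ∀ (ΩK : ℂ) (Ωp : ℂ_[3]) (Q : PowerSeries (PadicComplexInt 3)), ΩK ≠ 0 → Ωp ≠ 0 →
          R1.IsBDPLFunctionInt 3 ι' 𝔭 κ γ Dt.f ΩK Ωp Q →
          (XAc.charIdeal (W.baseChange K) 3 κ 𝔭' ∅ γ).map (PowerSeries.map (R1.toCpInt 3)) ≤ Ideal.span {Q}) :
    ∀ (W : WeierstrassCurve ℚ) [W.IsElliptic] [W.IsGloballyMinimal], W.analyticRank = 1 → ClassO6 W 3 →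
      AdditiveThree.TowerSurjThree W → R W → MissingLowerBoundAt W 3 := by
  intro W _ _ hr hO6 hT hR
  have hsurj := forall_hasSurjectiveModNGaloisRep_pow_three_of_towerSurjThree W hT
  have haddv : Addv W 3 := hO6.2.1
  have hj : 0 ≤ padicValRat 3 W.j := hO6.padicValRat_j_nonneg
  have hGZK : rank_eq_analyticRank_of_analyticRank_le_one := hF.2.2.1
  have hmod : hasEntireLFunction_rat := hF.2.2.2.1
  exact missingLowerBoundAt_of_flatEisenstein_of_controlLe_of_twistUpper_row 3 (by decide) hA hL hF W haddv hr
    (fun N _ K _ _ Dt hN hK hHN κ hκ γ _ 𝔭 h𝔭 he hf 𝔭' h𝔭' hne ι' hind ΩK Ωp Q hΩK hΩp hBDP ↦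
      hIncl W N K Dt hR hO6 hT hr hN hK hHN κ hκ γ 𝔭 h𝔭 he hf 𝔭' h𝔭' hne ι' hind ΩK Ωp Q hΩK hΩp hBDP)
    (fun N _ K _ _ Dt H ι P hN hK hHN _hLt hP hnt hKo κ hκ γ _ 𝔭 h𝔭 he hf ↦
      additiveControlLeOnTreeAt_of_poitouTate_of_heegner W 3 (by decide) haddv N K (hPT K) Dt H ι P hN hK hHN hP hnt
        hKo κ hκ γ 𝔭 h𝔭 he hf)
    (fun N _ K _ _ Wd _ _ hN hK hHN hC hLt ↦
      missingUpperBoundAt_twist_of_towerSurj_of_katoTam 3 (by decide) hKatoT hGZK hmod W haddv hj hsurj hN K hK hHN Wd hC hLt)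

end WildThree

end Summit.BirchSwinnertonDyer.BirchSwinnertonDyer.Theorems.AdditiveRankOneFlatLowerHalfControlLe

end
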